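import Summits.QuantumFields.YangMills.Theorems.BalabanUVNodesN15AtSpineCarriersVWordsCoarse
import Summits.QuantumFields.YangMills.Theorems.BalabanUVNodesN15VectorPieceSite

/-!
# YM-DAG node N15 (= NE2) AT THE RATE CARRIERS OF RECORD — THE (3.60) WORDS FAMILIES WITH TWO OF THE THREE CONJUNCTS BY NAME: operator layer (`vWGCVecFamily4`, g4 F16)
# AND site-kernel layer (`vWGCVecSiteKernel`, this seat's S6 — the dressed site kernel `[Q′(U′U)G′²(U′U)Q′*(U′U)]⁻¹` with the background LIVE); the K4 stub
# `YMDAG.UVSplit.S_N15 RRec` closed over every rate-carrier predicate whose NE2 component carries them — from the UNIT-LATTICE layer and the `U ≡ 1` site kernels alone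

Track A of `YM-PLAN.md` (cell `pub-ymgap`, HUMAN RULING D-0062), node **N15**; typed by seat `pub-ymgap-dag-n15-c` (generation g5) as the spine-carrier faces of its site-kernel
chain S1–S6 (`…N15BackgroundSiteNeumann` → `…SiteWords` → `…SiteReadout` → `…SiteOfLetters` → `…SiteByName` → `…VectorPieceSite`).  Shape twin: g4's
`…AtSpineCarriersVWordsCoarse` (same namespace; nothing restated — that file keeps the faces with the site layer DISPLAYED).  Producers consumed BY NAME:
`VectorPiece.ne2PlusOperator_vectorPiece_vWordsExpC` ∕ `…LinC` (operator conjunct), `VectorPiece.ne2PlusSite_vectorPiece_vWordsExpC` ∕ `…LinC` (site conjunct).  Kernel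
bookkeeping: 0 `def`, 0 `sorry`, standard axioms.  COUNT-NEUTRAL; `--supports` the K3⁗ item `SpineGivenEndpointR13Sep` (stmt-QuantumFields-20292, `--as helper`).

THE STUB.  `S_N15 RRec := ∀ F D g₀ os R, RRec F D g₀ os R → N15At R.ne2`, `N15At c := NE2PlusOperator c.c35 c.pi c.Kop ∧ NE2PlusSite 4 c.p c.c35 c.pi c.Ksite ∧
NE2PlusUnit c.c35 c.pi c.Kunit c.inΛ c.unitDist`.

WHAT THIS MODULE IS.  §1 faces `n15At_vectorPiece_vWordsExpC_site_of_unit`, `n15At_vectorPiece_vWordsLinC_site_of_unit` (for `d + 1 ≥ 2`, `L ≥ 1`, `c₃₅ > 0`, coordinates `e`,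
a (3.24) weight `a`, and `U ≡ 1` site kernels `Ws j, Ws′ j` with a uniform decaying majorant inverting `Q(G ⊗ 1)²Q*` ∕ `Q′(G′ ⊗ 1)²Q′*`: `N15At` from the UNIT-LATTICE layer
ALONE — operator AND site conjuncts by name).  §2 closers `s_N15_of_vWordsExpCSiteReading`, `s_N15_of_vWordsLinCSiteReading`.  §3 guards
`not_n15At_iff_unit_fails_vWordsExpCSite`, `…LinCSite`: on these carriers NEITHER the operator NOR the site layer is ever the reason `N15At` fails.

HONEST FRAMING.  NE2 is NOT PRINTED beyond King's scalar template and NOT PROVED for Bałaban's `G(U)`.  What enters hypothesis-free: the operator layer AND the site-kernel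
layer of the LINEAR (`U ≡ 1`) vector single-scale piece of [B5]∕[B6]∕King (4.42) ⊗ 1_𝔤, dressed by the (3.60)-shaped `V′(A′)` (gauge field the datum, coarse `V′₁` at the
mean field's triple), the dressed site kernel of (3.65)–(3.67) built from it by the exact inverse rule; what is DISPLAYED: the `U ≡ 1` SITE KERNELS (inverse of `QG²Q*`
for the vector piece, with decay — a [B5]∕King object, not an η-rate) and the UNIT-LATTICE layer `NE2PlusUnit`; (3.35) = our unit-scale reading of the printed C² pair;
transport = fibrewise mean (linearised (C3)); one-level contour; NOT the multiscale carrier of NODE 00.  N15 is NOT discharged (0∕1 at every record); typed 28∕28,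
discharged count untouched; one finite four-torus programme at fixed `ε` — NOT ℝ⁴, NOT infinite volume, NOT OS, NOT a mass gap, NOT Clay.  Restate-immune.  No decl
below carries a cite tag.
-/

noncomputable section

open Finset

namespace Summit.QuantumFields.YangMills.Theorems.N15AtSpineCarriers

open Literature.MathematicalPhysics.QuantumFieldTheory.Balaban1983to89
open Literature.MathematicalPhysics.QuantumFieldTheory.Balaban1983to89.T4Continuum
open Literature.MathematicalPhysics.QuantumFieldTheory.Balaban1983to89.B9 (SiteKernel)
open Literature.MathematicalPhysics.QuantumFieldTheory.Balaban1983to89.B11SectG (BlockNorm HasMaj)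
open Literature.MathematicalPhysics.QuantumFieldTheory.Balaban1983to89.T4EtaRate (PairedInstance NE2PlusOperator NE2PlusSite NE2PlusUnit)
open Literature.MathematicalPhysics.QuantumFieldTheory.Balaban1983to89.B5Prop11Plancherel (Tor fine)
open Summit.QuantumFields.YangMills.BalabanUVNodes.N15.MatrixSpecies (liftMap liftBlk)
open Summit.QuantumFields.YangMills.BalabanUVNodes.N15.SiteLayer (siteForm₀)
open Summit.QuantumFields.YangMills.BalabanUVNodes.N15.VectorPiece (VecIndexS v1GVecInstance vWGCVecFamily4 vWGCVecSiteKernel linFc linFsc linFf linFsf expFc expFsc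
  expFf expFsf ne2PlusOperator_vectorPiece_vWordsLinC ne2PlusOperator_vectorPiece_vWordsExpC ne2PlusSite_vectorPiece_vWordsExpC ne2PlusSite_vectorPiece_vWordsLinC
  unitTorusGeoS blkFine kingPrV qbond tensorId pieceG rweight)
open YMDAG.UVSplit (Datum NE2Carriers RateCarriers RateRecordPred N15At RatesAt S_N15)

variable {N : ℕ} [NeZero N] {d : ℕ} {L : ℕ} [NeZero L] {ι : Type} [Fintype ι] [DecidableEq ι]
  {𝔄 : Type} [NormedRing 𝔄] [NormedAlgebra ℝ 𝔄] [CompleteSpace 𝔄] (e : 𝔄 ≃L[ℝ] (ι → ℝ)) (a : ℝ)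

/-- THE `U ≡ 1` SITE-KERNEL DATUM of the faces below: coarse and fine inverse site kernels `Ws j, Ws′ j` on the unit-bond site lattice with a uniform decaying majorant
`β_W·e^{−δ_W d}` and the inverse identities against `Q(G ⊗ 1)²Q*` ∕ `Q′(G′ ⊗ 1)²Q′*` of the -a vector piece — the printed Thm 3.2 (3.48) object at `U ≡ 1`, DISPLAYED. [bookkeeping] -/
def SiteDatumW (Ws Ws' : ∀ j : VecIndexS d L, ((Tor j.Mn × Fin (d + 1)) × ι → ℝ) →ₗ[ℝ] ((Tor j.Mn × Fin (d + 1)) × ι → ℝ)) (βW δW : ℝ) : Prop :=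
  0 ≤ βW ∧ 0 < δW ∧
  (∀ j, HasMaj (BlockNorm.ofBlocks (unitTorusGeoS L j.k j.Mn j.Msz) (liftBlk (fun b : Tor j.Mn × Fin (d + 1) => b.1) ι))
      (BlockNorm.ofBlocks (unitTorusGeoS L j.k j.Mn j.Msz) (liftBlk (fun b : Tor j.Mn × Fin (d + 1) => b.1) ι)) (Ws j)
      (fun y y' => βW * Real.exp (-(δW * (unitTorusGeoS L j.k j.Mn j.Msz).dist y y')))) ∧
  (∀ j, HasMaj (BlockNorm.ofBlocks (unitTorusGeoS L j.k j.Mn j.Msz) (liftBlk (fun b : Tor j.Mn × Fin (d + 1) => b.1) ι))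
      (BlockNorm.ofBlocks (unitTorusGeoS L j.k j.Mn j.Msz) (liftBlk (fun b : Tor j.Mn × Fin (d + 1) => b.1) ι)) (Ws' j)
      (fun y y' => βW * Real.exp (-(δW * (unitTorusGeoS L j.k j.Mn j.Msz).dist y y')))) ∧
  (∀ j, siteForm₀ (liftMap (qbond L j.k j.Mn) ι) (tensorId ι (pieceG L j.Mn (L ^ j.k) j.k (rweight (d := d) L j.k))) ∘ₗ Ws j = LinearMap.id) ∧
  (∀ j, siteForm₀ (liftMap (qbond L j.k j.Mn) ι ∘ liftMap (kingPrV L j.k j.m j.Mn) ι)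
      (tensorId ι (pieceG L j.Mn (L ^ j.m * L ^ j.k) (j.k + j.m) (rweight (d := d) L j.k / ((L : ℝ) ^ j.m) ^ (d + 1)))) ∘ₗ Ws' j = LinearMap.id)

/-! ## §1 The node faces: `N15At` from the unit-lattice layer alone, operator AND site conjuncts by name -/

section Faces

variable {Ws Ws' : ∀ j : VecIndexS d L, ((Tor j.Mn × Fin (d + 1)) × ι → ℝ) →ₗ[ℝ] ((Tor j.Mn × Fin (d + 1)) × ι → ℝ)} {βW δW : ℝ}

/-- **`N15At` WITH THE FULL PERTURBATION AND THE PARALLEL-TRANSPORT SPECIES LIVE, FROM THE UNIT LAYER ALONE** (operator conjunct = F16's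
`ne2PlusOperator_vectorPiece_vWordsExpC`; site conjunct = S6's `ne2PlusSite_vectorPiece_vWordsExpC` at the displayed `U ≡ 1` site kernels). [bookkeeping] -/
theorem n15At_vectorPiece_vWordsExpC_site_of_unit (hd : 1 ≤ d) (hL : 1 ≤ L) {c35 : ℝ} (hc35 : 0 < c35) (p : ℝ) (hW : SiteDatumW (d := d) (ι := ι) (L := L) Ws Ws' βW δW)
    (Kunit : ∀ j : VecIndexS d L, SiteKernel (v1GVecInstance (d := d) 𝔄 ι L hL j).gc (v1GVecInstance (d := d) 𝔄 ι L hL j).Bf)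
    (inΛ : ∀ j : VecIndexS d L, (v1GVecInstance (d := d) 𝔄 ι L hL j).gc.Site → Prop)
    (unitDist : ∀ j : VecIndexS d L, (v1GVecInstance (d := d) 𝔄 ι L hL j).gc.Site → (v1GVecInstance (d := d) 𝔄 ι L hL j).gc.Site → ℝ)
    (hunit : NE2PlusUnit c35 (v1GVecInstance (d := d) 𝔄 ι L hL) Kunit inΛ unitDist) :
    N15At { I := VecIndexS d L, c35 := c35, p := p, pi := v1GVecInstance (d := d) 𝔄 ι L hL,
            Kop := vWGCVecFamily4 (d := d) 𝔄 ι e L a hL (expFc ι e L) (expFsc ι e L) (expFf ι e L) (expFsf ι e L),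
            Ksite := vWGCVecSiteKernel (d := d) 𝔄 ι e L a hL (expFc ι e L) (expFsc ι e L) (expFf ι e L) (expFsf ι e L) Ws Ws',
            Kunit := Kunit, inΛ := inΛ, unitDist := unitDist } := by
  obtain ⟨hβW, hδW, hWs, hWs', hKW, hKW'⟩ := hW
  exact ⟨ne2PlusOperator_vectorPiece_vWordsExpC (d := d) e a hd hL c35 hc35,
    ne2PlusSite_vectorPiece_vWordsExpC (d := d) e a hd hL c35 hc35 p Ws Ws' hβW hδW hWs hWs' hKW hKW', hunit⟩

/-- **`N15At` WITH THE FULL PERTURBATION AND THE LINEARISED SPECIES LIVE, FROM THE UNIT LAYER ALONE.** [bookkeeping] -/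
theorem n15At_vectorPiece_vWordsLinC_site_of_unit (hd : 1 ≤ d) (hL : 1 ≤ L) {c35 : ℝ} (hc35 : 0 < c35) (p : ℝ) (hW : SiteDatumW (d := d) (ι := ι) (L := L) Ws Ws' βW δW)
    (Kunit : ∀ j : VecIndexS d L, SiteKernel (v1GVecInstance (d := d) 𝔄 ι L hL j).gc (v1GVecInstance (d := d) 𝔄 ι L hL j).Bf)
    (inΛ : ∀ j : VecIndexS d L, (v1GVecInstance (d := d) 𝔄 ι L hL j).gc.Site → Prop)
    (unitDist : ∀ j : VecIndexS d L, (v1GVecInstance (d := d) 𝔄 ι L hL j).gc.Site → (v1GVecInstance (d := d) 𝔄 ι L hL j).gc.Site → ℝ)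
    (hunit : NE2PlusUnit c35 (v1GVecInstance (d := d) 𝔄 ι L hL) Kunit inΛ unitDist) :
    N15At { I := VecIndexS d L, c35 := c35, p := p, pi := v1GVecInstance (d := d) 𝔄 ι L hL,
            Kop := vWGCVecFamily4 (d := d) 𝔄 ι e L a hL (linFc ι e L) (linFsc ι e L) (linFf ι e L) (linFsf ι e L),
            Ksite := vWGCVecSiteKernel (d := d) 𝔄 ι e L a hL (linFc ι e L) (linFsc ι e L) (linFf ι e L) (linFsf ι e L) Ws Ws',
            Kunit := Kunit, inΛ := inΛ, unitDist := unitDist } := by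
  obtain ⟨hβW, hδW, hWs, hWs', hKW, hKW'⟩ := hW
  exact ⟨ne2PlusOperator_vectorPiece_vWordsLinC (d := d) e a hd hL c35 hc35,
    ne2PlusSite_vectorPiece_vWordsLinC (d := d) e a hd hL c35 hc35 p Ws Ws' hβW hδW hWs hWs' hKW hKW', hunit⟩

end Faces

/-! ## §2 (W2) closers: `S_N15` for every rate-record predicate whose NE2 component IS one of the two families plus the unit layer and the `U ≡ 1` site kernels -/

section Closers

/-- **`S_N15` FOR EVERY PARALLEL-TRANSPORT-SPECIES SITE READING**: neither the operator nor the site layer is a hypothesis. [bookkeeping] -/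
theorem s_N15_of_vWordsExpCSiteReading (hd : 1 ≤ d) (hL : 1 ≤ L) (RRec : RateRecordPred N)
    (hread : ∀ (F : T4Family) (D : Datum F N) (g₀ : ℕ → ℝ) (os : List (ULoop F)) (R : RateCarriers N), RRec F D g₀ os R →
      ∃ (c35 a p βW δW : ℝ) (Ws Ws' : ∀ j : VecIndexS d L, ((Tor j.Mn × Fin (d + 1)) × ι → ℝ) →ₗ[ℝ] ((Tor j.Mn × Fin (d + 1)) × ι → ℝ))
        (Kunit : ∀ j : VecIndexS d L, SiteKernel (v1GVecInstance (d := d) 𝔄 ι L hL j).gc (v1GVecInstance (d := d) 𝔄 ι L hL j).Bf)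
        (inΛ : ∀ j : VecIndexS d L, (v1GVecInstance (d := d) 𝔄 ι L hL j).gc.Site → Prop)
        (unitDist : ∀ j : VecIndexS d L, (v1GVecInstance (d := d) 𝔄 ι L hL j).gc.Site → (v1GVecInstance (d := d) 𝔄 ι L hL j).gc.Site → ℝ),
        0 < c35 ∧ SiteDatumW (d := d) (ι := ι) (L := L) Ws Ws' βW δW ∧
        R.ne2 = { I := VecIndexS d L, c35 := c35, p := p, pi := v1GVecInstance (d := d) 𝔄 ι L hL,
                  Kop := vWGCVecFamily4 (d := d) 𝔄 ι e L a hL (expFc ι e L) (expFsc ι e L) (expFf ι e L) (expFsf ι e L),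
                  Ksite := vWGCVecSiteKernel (d := d) 𝔄 ι e L a hL (expFc ι e L) (expFsc ι e L) (expFf ι e L) (expFsf ι e L) Ws Ws',
                  Kunit := Kunit, inΛ := inΛ, unitDist := unitDist } ∧
        NE2PlusUnit c35 (v1GVecInstance (d := d) 𝔄 ι L hL) Kunit inΛ unitDist) :
    S_N15 RRec := by
  intro F D g₀ os R hR
  obtain ⟨c35, a, p, βW, δW, Ws, Ws', Kunit, inΛ, unitDist, hc35, hW, hne2, hunit⟩ := hread F D g₀ os R hR
  rw [hne2]
  exact n15At_vectorPiece_vWordsExpC_site_of_unit e a hd hL hc35 p hW Kunit inΛ unitDist hunit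

/-- **`S_N15` FOR EVERY LINEARISED-SPECIES SITE READING.** [bookkeeping] -/
theorem s_N15_of_vWordsLinCSiteReading (hd : 1 ≤ d) (hL : 1 ≤ L) (RRec : RateRecordPred N)
    (hread : ∀ (F : T4Family) (D : Datum F N) (g₀ : ℕ → ℝ) (os : List (ULoop F)) (R : RateCarriers N), RRec F D g₀ os R →
      ∃ (c35 a p βW δW : ℝ) (Ws Ws' : ∀ j : VecIndexS d L, ((Tor j.Mn × Fin (d + 1)) × ι → ℝ) →ₗ[ℝ] ((Tor j.Mn × Fin (d + 1)) × ι → ℝ))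
        (Kunit : ∀ j : VecIndexS d L, SiteKernel (v1GVecInstance (d := d) 𝔄 ι L hL j).gc (v1GVecInstance (d := d) 𝔄 ι L hL j).Bf)
        (inΛ : ∀ j : VecIndexS d L, (v1GVecInstance (d := d) 𝔄 ι L hL j).gc.Site → Prop)
        (unitDist : ∀ j : VecIndexS d L, (v1GVecInstance (d := d) 𝔄 ι L hL j).gc.Site → (v1GVecInstance (d := d) 𝔄 ι L hL j).gc.Site → ℝ),
        0 < c35 ∧ SiteDatumW (d := d) (ι := ι) (L := L) Ws Ws' βW δW ∧
        R.ne2 = { I := VecIndexS d L, c35 := c35, p := p, pi := v1GVecInstance (d := d) 𝔄 ι L hL,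
                  Kop := vWGCVecFamily4 (d := d) 𝔄 ι e L a hL (linFc ι e L) (linFsc ι e L) (linFf ι e L) (linFsf ι e L),
                  Ksite := vWGCVecSiteKernel (d := d) 𝔄 ι e L a hL (linFc ι e L) (linFsc ι e L) (linFf ι e L) (linFsf ι e L) Ws Ws',
                  Kunit := Kunit, inΛ := inΛ, unitDist := unitDist } ∧
        NE2PlusUnit c35 (v1GVecInstance (d := d) 𝔄 ι L hL) Kunit inΛ unitDist) :
    S_N15 RRec := by
  intro F D g₀ os R hR
  obtain ⟨c35, a, p, βW, δW, Ws, Ws', Kunit, inΛ, unitDist, hc35, hW, hne2, hunit⟩ := hread F D g₀ os R hR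
  rw [hne2]
  exact n15At_vectorPiece_vWordsLinC_site_of_unit e a hd hL hc35 p hW Kunit inΛ unitDist hunit

end Closers

/-! ## §3 Guards: on these carriers NEITHER the operator NOR the site layer is ever the reason `N15At` fails -/

section Guard

variable {Ws Ws' : ∀ j : VecIndexS d L, ((Tor j.Mn × Fin (d + 1)) × ι → ℝ) →ₗ[ℝ] ((Tor j.Mn × Fin (d + 1)) × ι → ℝ)} {βW δW : ℝ}

/-- **PARALLEL-TRANSPORT-SPECIES CARRIERS WITH THE SITE KERNEL CONSTRUCTED: `N15At` FAILS IFF THE UNIT LAYER FAILS.** [bookkeeping] -/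
theorem not_n15At_iff_unit_fails_vWordsExpCSite (hd : 1 ≤ d) (hL : 1 ≤ L) {c35 : ℝ} (hc35 : 0 < c35) (p : ℝ)
    (hW : SiteDatumW (d := d) (ι := ι) (L := L) Ws Ws' βW δW)
    (Kunit : ∀ j : VecIndexS d L, SiteKernel (v1GVecInstance (d := d) 𝔄 ι L hL j).gc (v1GVecInstance (d := d) 𝔄 ι L hL j).Bf)
    (inΛ : ∀ j : VecIndexS d L, (v1GVecInstance (d := d) 𝔄 ι L hL j).gc.Site → Prop)
    (unitDist : ∀ j : VecIndexS d L, (v1GVecInstance (d := d) 𝔄 ι L hL j).gc.Site → (v1GVecInstance (d := d) 𝔄 ι L hL j).gc.Site → ℝ) :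
    ¬ N15At { I := VecIndexS d L, c35 := c35, p := p, pi := v1GVecInstance (d := d) 𝔄 ι L hL,
              Kop := vWGCVecFamily4 (d := d) 𝔄 ι e L a hL (expFc ι e L) (expFsc ι e L) (expFf ι e L) (expFsf ι e L),
              Ksite := vWGCVecSiteKernel (d := d) 𝔄 ι e L a hL (expFc ι e L) (expFsc ι e L) (expFf ι e L) (expFsf ι e L) Ws Ws',
              Kunit := Kunit, inΛ := inΛ, unitDist := unitDist } ↔
      ¬ NE2PlusUnit c35 (v1GVecInstance (d := d) 𝔄 ι L hL) Kunit inΛ unitDist := by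
  constructor
  · intro h hu
    exact h (n15At_vectorPiece_vWordsExpC_site_of_unit e a hd hL hc35 p hW Kunit inΛ unitDist hu)
  · rintro hu ⟨_, _, hunit⟩
    exact hu hunit

/-- **LINEARISED-SPECIES CARRIERS WITH THE SITE KERNEL CONSTRUCTED: `N15At` FAILS IFF THE UNIT LAYER FAILS.** [bookkeeping] -/
theorem not_n15At_iff_unit_fails_vWordsLinCSite (hd : 1 ≤ d) (hL : 1 ≤ L) {c35 : ℝ} (hc35 : 0 < c35) (p : ℝ)
    (hW : SiteDatumW (d := d) (ι := ι) (L := L) Ws Ws' βW δW)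
    (Kunit : ∀ j : VecIndexS d L, SiteKernel (v1GVecInstance (d := d) 𝔄 ι L hL j).gc (v1GVecInstance (d := d) 𝔄 ι L hL j).Bf)
    (inΛ : ∀ j : VecIndexS d L, (v1GVecInstance (d := d) 𝔄 ι L hL j).gc.Site → Prop)
    (unitDist : ∀ j : VecIndexS d L, (v1GVecInstance (d := d) 𝔄 ι L hL j).gc.Site → (v1GVecInstance (d := d) 𝔄 ι L hL j).gc.Site → ℝ) :
    ¬ N15At { I := VecIndexS d L, c35 := c35, p := p, pi := v1GVecInstance (d := d) 𝔄 ι L hL,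
              Kop := vWGCVecFamily4 (d := d) 𝔄 ι e L a hL (linFc ι e L) (linFsc ι e L) (linFf ι e L) (linFsf ι e L),
              Ksite := vWGCVecSiteKernel (d := d) 𝔄 ι e L a hL (linFc ι e L) (linFsc ι e L) (linFf ι e L) (linFsf ι e L) Ws Ws',
              Kunit := Kunit, inΛ := inΛ, unitDist := unitDist } ↔
      ¬ NE2PlusUnit c35 (v1GVecInstance (d := d) 𝔄 ι L hL) Kunit inΛ unitDist := by
  constructor
  · intro h hu
    exact h (n15At_vectorPiece_vWordsLinC_site_of_unit e a hd hL hc35 p hW Kunit inΛ unitDist hu)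
  · rintro hu ⟨_, _, hunit⟩
    exact hu hunit

end Guard

end Summit.QuantumFields.YangMills.Theorems.N15AtSpineCarriers

end
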